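import Mathlib
import Literature.MathematicalPhysics.QuantumLattice.TorusTestPotential

/-!
# Beta/CombesThomasForm — the Combes–Thomas estimate in QUADRATIC-FORM version, with rates uniform in the lattice
spacing (β sub-cell row an2, HOME/BETA/AN2.md v0.4.4 §8.11 (g): member 1 of the kernel programme (L6-unit″))

HONEST FRAMING (page 1).  This module belongs to the audit package of T. Bałaban's lattice Yang–Mills programme
(cell `pub-balaban`).  It is ELEMENTARY FINITE-DIMENSIONAL LINEAR ALGEBRA (folklore; Combes–Thomas 1973), proved
from Mathlib alone; it quotes nothing from the manuscripts under audit and asserts nothing about them.  Discharging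
`FlowStep.BetaPertH` (towards which the row works) would make Bałaban's ultraviolet stability UNCONDITIONAL — NOT
the continuum limit, NOT the Clay problem; this file is not summit progress.

WHY THIS FILE.  AN2.md §8.11 (g) reduces the `L`-uniformity of the unit-sector one-loop coefficient `u_k(L)` to
(L6-unit″): exponential cube-to-cube decay, with constants depending on `d, a` only, of a finite list of
translation-invariant operators at unit background on the fine torus `T_η`, FOR EVERY mesh `η = 1/n` (each operator
depends on `(L, k)` only through `η = L^{−k}`, [Balaban1984PropagatorsI] (1.18) p. 20).  In print the decay is stated
along `η = L^{−k}` only ([Balaban1984PropagatorsI] Prop. 1.2 pp. 35–36, «δ₀ depending on d only»; cell census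
C-B5-5: the printed proof runs through the `L`-adic tower (1.133)–(1.137)).  The simplest member of the list is
`G₀ = (Δ^η + aQ*Q)⁻¹` (fine Laplacian plus `a` times the unit-cube block projection).  Its all-`η` decay is a
COMBES–THOMAS argument, provided the conjugation error is estimated in QUADRATIC-FORM (not entrywise) fashion: the
Laplacian's bond coefficients are `η⁻²`, so an entrywise (Schur) estimate of the conjugation error — as in the sibling
tree modules `Literature.Analysis.OperatorTheory.CombesThomasBanded.combesThomas_banded` (needs
`h·z·(e^μ − 1) ≤ σ/2` with `h` = sup of the off-diagonal entries), `Literature.Analysis.Matrix.QuadraticCombesThomas`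
(range-one `A` in the metric of the weight) and the cell's own `…Balaban1983to89.QGQInverse.inverse_decay` (Schur
row/column smallness `Σ_j |S_ij|(e^{κ d_ij} − 1) ≤ ρ < γ`, i.e. `≈ 2dκ/η` for the fine Laplacian) — forces a rate
`O(η)` or worse in physical distance, resp. a weight of fine-lattice range, whereas
the form version below exploits that the FIRST-ORDER part of the conjugation error of a graph Laplacian is
antisymmetric and cancels, leaving `c_jk (cosh(φ_j − φ_k) − 1) ≤ η⁻²·(δη)² = δ²` per bond (§0): a rate `δ` in
PHYSICAL distance, uniform in `η`.  This is the standard mechanism (Combes–Thomas 1973; Agmon; e.g. Aizenman–Warzel,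
*Random Operators*, §10.3); what is supplied here is its kernel-checked finite-dimensional form, abstract over the
index set, so that whoever types the fine torus (cf. the cell's `B5Block118` / `B5Blocks16`, general `n`) can
instantiate it without re-proving analysis.  (Complementary to, and disjoint from, the r1 lineage's block-L² majorant
algebra for the Sect.-D operators — journal claim SECTD-L2-DECAY — which takes the decay of `G₀` as an input.)

CONTENTS (all PROVED, 0 sorry; no definitions except the graph Laplacian `lap`; imports Mathlib and the landed
`QuantumLattice.TorusTestPotential` for one elementary `cosh` inequality).
§0 `inv_sq_mul_cosh_sub_one_le` (`|t| ≤ δη ≤ 1 → η⁻²(cosh t − 1) ≤ δ²`: the per-bond defect is second order,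
   uniformly in `η`; uses the landed `Literature.MathematicalPhysics.QuantumLattice.cosh_sub_one_le_sq_of_abs_le_one`).
§1 `combesThomas_form` — for a real matrix `H` with `σ‖ω‖² ≤ ⟨ω, Hω⟩` and an ARBITRARY weight `φ` whose
   conjugation error satisfies `−(σ/2)‖w‖² ≤ Σ_{j,k} (e^{φ_j − φ_k} − 1) H_jk w_j w_k`, every solution of `Hv = e_{k₀}`
   obeys `|v_i| ≤ (2/σ) e^{−(φ_i − φ_{k₀})}`.
§2 `lap`, `lap_mulVec`, `lap_form` (`⟨v, lap c v⟩ = ½ Σ c_jk (v_j − v_k)²`); `conjError_lap_ge` — for symmetric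
   `c ≥ 0` the conjugation error of `lap c` is `≥ −κ‖w‖²` with `κ = max_j Σ_k c_jk (cosh(φ_j − φ_k) − 1)` (the
   symmetrisation that kills the first order); `conjError_blocks_ge` — for a block-diagonal sum of rank-one terms
   `Σ_b m_b u_b ⊗ u_b` (`u_b` supported in block `b`) the error is `≥ −κ‖w‖²` with `κ = max_b m_b ε_b ‖u_b‖²`,
   `ε_b` = the oscillation `max_{j,k∈b} |e^{φ_j − φ_k} − 1|`.
§3 `combesThomas_lap_add_blocks` — the assembly: `H = lap c + Σ_b m_b u_b ⊗ u_b`, coercive with `σ`, and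
   `κ_Δ + κ_Q ≤ σ/2` ⇒ `|H⁻¹(i, k₀)| ≤ (2/σ) e^{−(φ_i − φ_{k₀})}`.
§4 `abs_exp_sub_one_le`, `lapDefect_le` (coefficients `η⁻²` on ≤ `z` neighbours, oscillation `≤ δη ≤ 1` across bonds
   ⇒ row defect `≤ zδ²`, no `η`), `blockDefect_le`, and **`combesThomas_lattice`**: in the shape `Δ^η + aQ*Q` the
   smallness condition reads `z δ² + a(e^Θ − 1) ≤ σ/2` — the spacing `η` does not appear — and the decay
   `|H⁻¹(i,k₀)| ≤ (2/σ) e^{−(φ_i − φ_{k₀})}` follows for every `η`.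
HOW IT IS MEANT TO BE INSTANTIATED (remark, not a theorem of this file): fine torus of mesh `η = 1/n`, `c_jk = η⁻²`
on nearest neighbours (≤ 2d per site), blocks = unit cubes, `m_b u_b ⊗ u_b` = `a ×` the cube-average projection,
`φ = δ ×` (a function 1-Lipschitz in physical distance, e.g. the ℓ¹-distance to the cube of `k₀`), `δη ≤ 1`: then
§0 gives `κ_Δ ≤ 2dδ²`, `κ_Q ≤ a(e^{δd} − 1)` (oscillation of `φ` on a unit cube ≤ δd in ℓ¹), and `σ = σ(d, a)` is the
all-`n` lower bound of `Δ^η + aQ*Q` (discrete Poincaré on cubes); choosing `δ = δ(d, a)` with `2dδ² + a(e^{δd} − 1)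
≤ σ/2` yields `|(H⁻¹)_{xy}| ≤ (2/σ) e^{−δ(dist(x,y) − d)}` for EVERY `n` and every torus, for the COUNTING-COORDINATE
matrix entry `(H⁻¹)_{xy} = η^d G₀(x, y)` (Bałaban's kernels act through `Σ_y η^d`); as an ENTRYWISE statement about
`G₀` itself this carries the factor `η^{−d}` and is NOT the `η`-uniform cube-to-cube statement (L6-unit″) asks for
(v1.0.1 correction; XREAD objection G-pv23g3-3 by unit `b2b-balaban-pv23-g3`, accepted in HOME/BETA/AN2.md v0.5
§8.11(h′)).  The `η`-UNIFORM statement is the OPERATOR (weighted `ℓ²`) form of the same argument —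
`‖1_S H⁻¹ 1_T‖_{ℓ²→ℓ²} ≤ (2/σ) e^{−δ·dist(S,T)}`, which in Bałaban's normalisation is
`‖1_S G₀ 1_T‖_{L²(T_η)→L²(T_η)}` (the (1.114)-type norm of [Balaban1984PropagatorsI] p. 36) — proved in the sibling
`Beta/CombesThomasFormOp` (`combesThomas_form_op`, `setDecay_lattice_dist`) and instantiated on the torus with the
all-`n` Poincaré constant in `Beta/BlockPoincare`, `Beta/CoordCubePoincare`, `Beta/TorusG0Decay.setDecay_torus`
(unit `b2b-balaban-pv23-g3`); the (1.110) `L^∞`-type bound needs in addition a local `ℓ² → ℓ^∞` regularity input,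
not Combes–Thomas.  The other members (`𝒟_a⁻¹` with its non-local but exponentially localised gauge term,
`(Q G Q*)⁻¹`, the minimiser) need the same §1 with an additional error term for exponentially decaying non-local
parts; not in this file.

References: J.-M. Combes, L. Thomas, Commun. Math. Phys. 34 (1973) 251–270 [CombesThomas1973]; M. Aizenman,
S. Warzel, *Random Operators* (AMS 2015) §10.3 [AizenmanWarzel2015]; T. Bałaban, Commun. Math. Phys. 95 (1984) 17–40
[Balaban1984PropagatorsI] (context only: (1.18) p. 20, Prop. 1.2 pp. 35–36).  Unit `b2b-balaban-beta-an2-g2`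
(BETA cell, row an2, gen 2); v1.0.1 docstring-only correction of the two USE sentences (η-normalisation of `G₀`;
pointer to the operator form) by unit `b2b-balaban-beta-an2-g3` after XREAD G-pv23g3-3 — no declaration changed;
staged byte-identically under `HOME/lean/BalabanYm4/`.  NOT summit progress.
-/

namespace Literature.MathematicalPhysics.QuantumFieldTheory.Balaban1983to89.Beta.CombesThomasForm

open Finset Matrix

variable {n : Type*} [Fintype n] [DecidableEq n]

/-! ## §0  The per-bond defect is second order -/

/-- Scaled form: a bond coefficient `η⁻²` times the conjugation defect is at most `δ²` when the weight oscillates by at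
most `δη ≤ 1` across the bond — UNIFORMLY in the lattice spacing `η`. [folklore] -/
theorem inv_sq_mul_cosh_sub_one_le {η δ t : ℝ} (hη : 0 < η) (ht : |t| ≤ δ * η) (h1 : δ * η ≤ 1) :
    (η ^ 2)⁻¹ * (Real.cosh t - 1) ≤ δ ^ 2 := by
  have hct : Real.cosh t - 1 ≤ t ^ 2 :=
    Literature.MathematicalPhysics.QuantumLattice.cosh_sub_one_le_sq_of_abs_le_one (ht.trans h1)
  have ht2 : t ^ 2 ≤ (δ * η) ^ 2 := by
    calc t ^ 2 = |t| ^ 2 := (sq_abs t).symm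
      _ ≤ (δ * η) ^ 2 := pow_le_pow_left₀ (abs_nonneg t) ht 2
  rw [inv_mul_le_iff₀ (by positivity)]
  calc Real.cosh t - 1 ≤ (δ * η) ^ 2 := hct.trans ht2
    _ = η ^ 2 * δ ^ 2 := by ring

/-! ## §1  Combes–Thomas in quadratic-form version, arbitrary weight -/

/-- **Combes–Thomas, form version.**  `H` a real matrix with `σ‖ω‖² ≤ ⟨ω, Hω⟩` (`σ > 0`), `φ` ANY weight whose
conjugation error is form-bounded by `σ/2`: `−(σ/2)‖w‖² ≤ Σ_{j,k} (e^{φ_j − φ_k} − 1) H_jk w_j w_k` for all `w`.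
Then every solution of `H v = e_{k₀}` satisfies `|v_i| ≤ (2/σ) e^{−(φ_i − φ_{k₀})}`.  Proof: with
`w_j = e^{φ_j − φ_{k₀}} v_j`, `Σ_{j,k} e^{φ_j−φ_k} H_jk w_j w_k = Σ_j e^{2(φ_j − φ_{k₀})} v_j (Hv)_j = w_{k₀}`, and the
left side is `⟨w,Hw⟩ + error ≥ (σ/2)‖w‖²`; so `‖w‖ ≤ 2/σ`. [cite: CombesThomas1973, §II] [folklore] -/
theorem combesThomas_form (H : Matrix n n ℝ) (σ : ℝ) (φ : n → ℝ) (hσ : 0 < σ)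
    (hpos : ∀ ω : n → ℝ, σ * (ω ⬝ᵥ ω) ≤ ω ⬝ᵥ H.mulVec ω)
    (herr : ∀ w : n → ℝ,
      -(σ / 2) * (w ⬝ᵥ w) ≤ ∑ j, ∑ k, (Real.exp (φ j - φ k) - 1) * H j k * (w j * w k))
    (k₀ : n) (v : n → ℝ) (hv : H.mulVec v = Pi.single k₀ 1) (i : n) :
    |v i| ≤ 2 / σ * Real.exp (-(φ i - φ k₀)) := by
  set w : n → ℝ := fun j => Real.exp (φ j - φ k₀) * v j with hw
  -- the conjugated equation: e^{φ_j − φ_{k₀}} (Hv)_j = Σ_k e^{φ_j − φ_k} H_jk w_k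
  have hEAv : ∀ j, Real.exp (φ j - φ k₀) * (H.mulVec v) j = ∑ k, Real.exp (φ j - φ k) * H j k * w k := by
    intro j
    simp only [mulVec, dotProduct, hw, Finset.mul_sum, Real.exp_sub]
    refine Finset.sum_congr rfl fun k _ => ?_
    field_simp
  have hlhs : ∑ j, w j * (Real.exp (φ j - φ k₀) * (H.mulVec v) j) = w k₀ := by
    simp only [hv]
    rw [Finset.sum_eq_single k₀]
    · simp
    · intro j _ hj; simp [hj]
    · intro h; exact absurd (Finset.mem_univ _) h
  have hsplit : ∑ j, w j * (Real.exp (φ j - φ k₀) * (H.mulVec v) j) =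
      w ⬝ᵥ H.mulVec w + ∑ j, ∑ k, (Real.exp (φ j - φ k) - 1) * H j k * (w j * w k) := by
    have h0 : ∑ j, w j * (Real.exp (φ j - φ k₀) * (H.mulVec v) j) =
        ∑ j, w j * ∑ k, Real.exp (φ j - φ k) * H j k * w k :=
      Finset.sum_congr rfl fun j _ => by rw [hEAv j]
    rw [h0]
    simp only [dotProduct, mulVec, Finset.mul_sum, ← Finset.sum_add_distrib]
    refine Finset.sum_congr rfl fun j _ => Finset.sum_congr rfl fun k _ => by ring
  -- assemble: (σ/2)‖w‖² ≤ w k₀ ≤ ‖w‖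
  set S : ℝ := ∑ j, w j ^ 2 with hS
  have hS0 : 0 ≤ S := Finset.sum_nonneg fun j _ => sq_nonneg _
  have hww : w ⬝ᵥ w = S := by
    simp only [dotProduct, hS]; exact Finset.sum_congr rfl fun j _ => by ring
  have hmain : σ / 2 * S ≤ w k₀ := by
    have h1 := hpos w
    have h2 := herr w
    rw [hww] at h1 h2
    linarith [hlhs, hsplit]
  have hk0 : w k₀ ^ 2 ≤ S :=
    Finset.single_le_sum (f := fun j => w j ^ 2) (fun j _ => sq_nonneg _) (Finset.mem_univ k₀)
  have hi : w i ^ 2 ≤ S :=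
    Finset.single_le_sum (f := fun j => w j ^ 2) (fun j _ => sq_nonneg _) (Finset.mem_univ i)
  have hSle : S ≤ (2 / σ) ^ 2 := by
    by_cases hS' : S = 0
    · rw [hS']; positivity
    · have hSpos : 0 < S := lt_of_le_of_ne hS0 (Ne.symm hS')
      have h1 : (σ / 2 * S) ^ 2 ≤ S := by
        have h0 : 0 ≤ σ / 2 * S := by positivity
        calc (σ / 2 * S) ^ 2 ≤ w k₀ ^ 2 := pow_le_pow_left₀ h0 hmain 2
          _ ≤ S := hk0
      have h2 : (σ / 2) ^ 2 * S ≤ 1 := by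
        have : (σ / 2 * S) ^ 2 = (σ / 2) ^ 2 * S * S := by ring
        rw [this] at h1
        exact le_of_mul_le_mul_right (by linarith) hSpos
      rw [div_pow, le_div_iff₀ (by positivity)]
      have : (σ / 2) ^ 2 = σ ^ 2 / 2 ^ 2 := by ring
      rw [this, div_mul_eq_mul_div, div_le_iff₀ (by positivity)] at h2
      linarith
  have hwi : |w i| ≤ 2 / σ := by
    have h1 : w i ^ 2 ≤ (2 / σ) ^ 2 := hi.trans hSle
    have h2 : 0 ≤ 2 / σ := by positivity
    exact abs_le.2 (abs_le_of_sq_le_sq' h1 h2)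
  -- undo the weight
  have hvi : v i = Real.exp (-(φ i - φ k₀)) * w i := by
    simp only [hw]
    rw [← mul_assoc, ← Real.exp_add, neg_add_cancel, Real.exp_zero, one_mul]
  rw [hvi, abs_mul, Real.abs_exp, mul_comm]
  exact mul_le_mul_of_nonneg_right hwi (Real.exp_pos _).le

/-! ## §2  The two conjugation-error estimates -/

/-- The weighted graph Laplacian of a coefficient function `c`: `(lap c · v)_j = Σ_k c_jk (v_j − v_k)`
(the value of `c j j` is immaterial). [folklore] -/
def lap (c : n → n → ℝ) : Matrix n n ℝ := fun j k => (if j = k then ∑ l, c j l else 0) - c j k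

/-- Entries of `lap c` (definitional unfolding). [folklore] -/
theorem lap_apply (c : n → n → ℝ) (j k : n) :
    lap c j k = (if j = k then ∑ l, c j l else 0) - c j k := rfl

/-- `(lap c · v)_j = Σ_k c_jk (v_j − v_k)`. [folklore] -/
theorem lap_mulVec (c : n → n → ℝ) (v : n → ℝ) (j : n) :
    (lap c).mulVec v j = ∑ k, c j k * (v j - v k) := by
  simp only [mulVec, dotProduct, lap_apply, sub_mul, Finset.sum_sub_distrib, ite_mul, zero_mul,
    Finset.sum_ite_eq, Finset.mem_univ, if_true, Finset.sum_mul, mul_sub]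

/-- `⟨v, lap c v⟩ = ½ Σ_{j,k} c_jk (v_j − v_k)²` for symmetric `c` — in particular `lap c` is positive
semi-definite when `c ≥ 0`. [folklore] -/
theorem lap_form (c : n → n → ℝ) (hc : ∀ j k, c j k = c k j) (v : n → ℝ) :
    v ⬝ᵥ (lap c).mulVec v = (∑ j, ∑ k, c j k * (v j - v k) ^ 2) / 2 := by
  have h1 : v ⬝ᵥ (lap c).mulVec v = ∑ j, ∑ k, c j k * (v j * (v j - v k)) := by
    simp only [dotProduct, lap_mulVec, Finset.mul_sum]
    exact Finset.sum_congr rfl fun j _ => Finset.sum_congr rfl fun k _ => by ring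
  have h2 : ∑ j, ∑ k, c j k * (v j * (v j - v k)) = ∑ j, ∑ k, c j k * (v k * (v k - v j)) := by
    rw [Finset.sum_comm]
    exact Finset.sum_congr rfl fun j _ => Finset.sum_congr rfl fun k _ => by rw [hc k j]
  rw [h1, eq_div_iff (two_ne_zero), mul_two]
  conv_lhs => rw [h2]; arg 1; rw [← h2]
  rw [← Finset.sum_add_distrib]
  refine Finset.sum_congr rfl fun j _ => ?_
  rw [← Finset.sum_add_distrib]
  exact Finset.sum_congr rfl fun k _ => by ring

/-- **Conjugation error of a graph Laplacian (the symmetrisation that kills the first order).**  For symmetric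
`c ≥ 0` and any weight `φ`: `Σ_{j,k} (e^{φ_j−φ_k} − 1)(lap c)_jk w_j w_k = −Σ_{j,k} (cosh(φ_j − φ_k) − 1) c_jk w_j w_k
≥ −κ‖w‖²` whenever every row sum `Σ_k c_jk (cosh(φ_j − φ_k) − 1)` is `≤ κ`. [folklore] -/
theorem conjError_lap_ge (c : n → n → ℝ) (hc : ∀ j k, c j k = c k j) (hc0 : ∀ j k, 0 ≤ c j k)
    (φ : n → ℝ) (κ : ℝ) (hκ : ∀ j, ∑ k, c j k * (Real.cosh (φ j - φ k) - 1) ≤ κ) (w : n → ℝ) :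
    -κ * (w ⬝ᵥ w) ≤ ∑ j, ∑ k, (Real.exp (φ j - φ k) - 1) * lap c j k * (w j * w k) := by
  -- Step 1: the diagonal of `lap` drops out (e⁰ − 1 = 0)
  have h1 : ∑ j, ∑ k, (Real.exp (φ j - φ k) - 1) * lap c j k * (w j * w k)
      = -∑ j, ∑ k, (Real.exp (φ j - φ k) - 1) * c j k * (w j * w k) := by
    rw [← Finset.sum_neg_distrib]
    refine Finset.sum_congr rfl fun j _ => ?_
    rw [← Finset.sum_neg_distrib]
    refine Finset.sum_congr rfl fun k _ => ?_
    by_cases hjk : j = k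
    · subst hjk; simp
    · simp only [lap_apply, if_neg hjk, zero_sub]; ring
  -- Step 2: symmetrisation, e^{t} − 1 ↦ cosh t − 1
  have hcosh : ∀ j k, Real.cosh (φ j - φ k) - 1 =
      ((Real.exp (φ j - φ k) - 1) + (Real.exp (φ k - φ j) - 1)) / 2 := by
    intro j k
    rw [Real.cosh_eq, show φ k - φ j = -(φ j - φ k) by ring]
    ring
  have hswap : ∑ j, ∑ k, (Real.exp (φ j - φ k) - 1) * c j k * (w j * w k)
      = ∑ j, ∑ k, (Real.exp (φ k - φ j) - 1) * c j k * (w j * w k) := by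
    rw [Finset.sum_comm]
    exact Finset.sum_congr rfl fun j _ => Finset.sum_congr rfl fun k _ => by rw [hc k j]; ring
  have h2 : ∑ j, ∑ k, (Real.exp (φ j - φ k) - 1) * c j k * (w j * w k)
      = ∑ j, ∑ k, (Real.cosh (φ j - φ k) - 1) * c j k * (w j * w k) := by
    have h3 : ∑ j, ∑ k, (Real.cosh (φ j - φ k) - 1) * c j k * (w j * w k)
        = (∑ j, ∑ k, (Real.exp (φ j - φ k) - 1) * c j k * (w j * w k)
            + ∑ j, ∑ k, (Real.exp (φ k - φ j) - 1) * c j k * (w j * w k)) / 2 := by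
      rw [← Finset.sum_add_distrib, Finset.sum_div]
      refine Finset.sum_congr rfl fun j _ => ?_
      rw [← Finset.sum_add_distrib, Finset.sum_div]
      exact Finset.sum_congr rfl fun k _ => by rw [hcosh j k]; ring
    rw [h3, ← hswap]; ring
  -- Step 3: |w_j w_k| ≤ (w_j² + w_k²)/2 and the row-sum bound
  have ha0 : ∀ j k, 0 ≤ (Real.cosh (φ j - φ k) - 1) * c j k := fun j k =>
    mul_nonneg (by linarith [Real.one_le_cosh (φ j - φ k)]) (hc0 j k)
  have hasymm : ∀ j k, (Real.cosh (φ j - φ k) - 1) * c j k = (Real.cosh (φ k - φ j) - 1) * c k j := by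
    intro j k; rw [hc j k, show φ k - φ j = -(φ j - φ k) by ring, Real.cosh_neg]
  have hX : ∑ j, ∑ k, (Real.cosh (φ j - φ k) - 1) * c j k * w k ^ 2
      = ∑ j, ∑ k, (Real.cosh (φ j - φ k) - 1) * c j k * w j ^ 2 := by
    rw [Finset.sum_comm]
    exact Finset.sum_congr rfl fun j _ => Finset.sum_congr rfl fun k _ => by rw [hasymm j k]
  have hT : ∑ j, ∑ k, (Real.cosh (φ j - φ k) - 1) * c j k * (w j * w k) ≤ κ * (w ⬝ᵥ w) := by
    calc ∑ j, ∑ k, (Real.cosh (φ j - φ k) - 1) * c j k * (w j * w k)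
        ≤ ∑ j, ∑ k, (Real.cosh (φ j - φ k) - 1) * c j k * ((w j ^ 2 + w k ^ 2) / 2) := by
          refine Finset.sum_le_sum fun j _ => Finset.sum_le_sum fun k _ => ?_
          exact mul_le_mul_of_nonneg_left (by nlinarith [sq_nonneg (w j - w k)]) (ha0 j k)
      _ = (∑ j, ∑ k, (Real.cosh (φ j - φ k) - 1) * c j k * w j ^ 2) / 2
            + (∑ j, ∑ k, (Real.cosh (φ j - φ k) - 1) * c j k * w k ^ 2) / 2 := by
          rw [Finset.sum_div, Finset.sum_div, ← Finset.sum_add_distrib]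
          refine Finset.sum_congr rfl fun j _ => ?_
          rw [Finset.sum_div, Finset.sum_div, ← Finset.sum_add_distrib]
          exact Finset.sum_congr rfl fun k _ => by ring
      _ = ∑ j, w j ^ 2 * ∑ k, (Real.cosh (φ j - φ k) - 1) * c j k := by
          rw [hX, add_halves]
          refine Finset.sum_congr rfl fun j _ => ?_
          rw [Finset.mul_sum]
          exact Finset.sum_congr rfl fun k _ => by ring
      _ ≤ ∑ j, w j ^ 2 * κ := by
          refine Finset.sum_le_sum fun j _ => mul_le_mul_of_nonneg_left ?_ (sq_nonneg _)
          calc ∑ k, (Real.cosh (φ j - φ k) - 1) * c j k = ∑ k, c j k * (Real.cosh (φ j - φ k) - 1) :=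
                Finset.sum_congr rfl fun k _ => mul_comm _ _
            _ ≤ κ := hκ j
      _ = κ * (w ⬝ᵥ w) := by
          rw [← Finset.sum_mul, mul_comm]
          simp only [dotProduct, pow_two]
  rw [h1, h2]
  linarith

omit [DecidableEq n] in
/-- **Conjugation error of a block-diagonal sum of rank-one terms.**  Blocks `blk : n → β`; per block a vector `u_b`
supported in block `b`, a coefficient `m_b ≥ 0`, and `ε_b ≥ max_{j,k ∈ b} |e^{φ_j − φ_k} − 1|` (the oscillation of the
weight on the block).  Then `Σ_{j,k} (e^{φ_j−φ_k} − 1)(Σ_b m_b u_bj u_bk) w_j w_k ≥ −κ‖w‖²` with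
`κ ≥ max_b m_b ε_b ‖u_b‖²` (Cauchy–Schwarz on each block; the blocks partition the index set). [folklore] -/
theorem conjError_blocks_ge {β : Type*} [Fintype β] [DecidableEq β] (blk : n → β) (m : β → ℝ)
    (hm : ∀ b, 0 ≤ m b) (u : β → n → ℝ) (hu : ∀ b j, blk j ≠ b → u b j = 0) (φ : n → ℝ) (ε : β → ℝ)
    (hε0 : ∀ b, 0 ≤ ε b) (hε : ∀ b j k, blk j = b → blk k = b → |Real.exp (φ j - φ k) - 1| ≤ ε b)
    (κ : ℝ) (hκ : ∀ b, m b * ε b * ∑ k, u b k ^ 2 ≤ κ) (w : n → ℝ) :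
    -κ * (w ⬝ᵥ w) ≤
      ∑ j, ∑ k, (Real.exp (φ j - φ k) - 1) * (∑ b, m b * (u b j * u b k)) * (w j * w k) := by
  -- block-wise weight of `w`
  set W : β → ℝ := fun b => ∑ j, if blk j = b then w j ^ 2 else 0 with hW
  have hW0 : ∀ b, 0 ≤ W b := fun b => Finset.sum_nonneg fun j _ => by split_ifs <;> positivity
  have hWsum : ∑ b, W b = w ⬝ᵥ w := by
    have h1 : ∑ b, W b = ∑ j, ∑ b, (if blk j = b then w j ^ 2 else 0) := by
      simp only [hW]; exact Finset.sum_comm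
    rw [h1]
    simp only [dotProduct, pow_two]
    exact Finset.sum_congr rfl fun j _ => by rw [Finset.sum_ite_eq]; simp
  -- pull the block sum out
  have hpull : ∑ j, ∑ k, (Real.exp (φ j - φ k) - 1) * (∑ b, m b * (u b j * u b k)) * (w j * w k)
      = ∑ b, m b * ∑ j, ∑ k, (Real.exp (φ j - φ k) - 1) * (u b j * u b k) * (w j * w k) := by
    symm
    calc ∑ b, m b * ∑ j, ∑ k, (Real.exp (φ j - φ k) - 1) * (u b j * u b k) * (w j * w k)
        = ∑ b, ∑ j, ∑ k, m b * ((Real.exp (φ j - φ k) - 1) * (u b j * u b k) * (w j * w k)) := by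
          refine Finset.sum_congr rfl fun b _ => ?_
          rw [Finset.mul_sum]
          exact Finset.sum_congr rfl fun j _ => Finset.mul_sum _ _ _
      _ = ∑ j, ∑ b, ∑ k, m b * ((Real.exp (φ j - φ k) - 1) * (u b j * u b k) * (w j * w k)) :=
          Finset.sum_comm
      _ = ∑ j, ∑ k, ∑ b, m b * ((Real.exp (φ j - φ k) - 1) * (u b j * u b k) * (w j * w k)) :=
          Finset.sum_congr rfl fun j _ => Finset.sum_comm
      _ = ∑ j, ∑ k, (Real.exp (φ j - φ k) - 1) * (∑ b, m b * (u b j * u b k)) * (w j * w k) := by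
          refine Finset.sum_congr rfl fun j _ => Finset.sum_congr rfl fun k _ => ?_
          rw [Finset.mul_sum, Finset.sum_mul]
          exact Finset.sum_congr rfl fun b _ => by ring
  -- per block: the inner double sum is ≥ −ε_b ‖u_b‖² W_b
  have hblock : ∀ b, -(ε b * (∑ k, u b k ^ 2) * W b) ≤
      ∑ j, ∑ k, (Real.exp (φ j - φ k) - 1) * (u b j * u b k) * (w j * w k) := by
    intro b
    -- termwise absolute bound
    have hterm : ∀ j k, |(Real.exp (φ j - φ k) - 1) * (u b j * u b k) * (w j * w k)| ≤
        ε b * (|u b j| * |if blk j = b then w j else 0|) * (|u b k| * |if blk k = b then w k else 0|) := by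
      intro j k
      by_cases hj : blk j = b
      · by_cases hk : blk k = b
        · rw [if_pos hj, if_pos hk, abs_mul, abs_mul, abs_mul, abs_mul]
          have := hε b j k hj hk
          calc |Real.exp (φ j - φ k) - 1| * (|u b j| * |u b k|) * (|w j| * |w k|)
              ≤ ε b * (|u b j| * |u b k|) * (|w j| * |w k|) := by gcongr
            _ = ε b * (|u b j| * |w j|) * (|u b k| * |w k|) := by ring
        · rw [hu b k hk]; simp
      · rw [hu b j hj]; simp
    -- Cauchy–Schwarz on the block
    have hCS : (∑ j, |u b j| * |if blk j = b then w j else 0|) ^ 2 ≤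
        (∑ j, |u b j| ^ 2) * ∑ j, |if blk j = b then w j else 0| ^ 2 :=
      Finset.sum_mul_sq_le_sq_mul_sq univ _ _
    have hu2 : ∑ j, |u b j| ^ 2 = ∑ k, u b k ^ 2 := Finset.sum_congr rfl fun j _ => sq_abs _
    have hw2 : ∑ j, |if blk j = b then w j else 0| ^ 2 = W b := by
      simp only [hW]
      exact Finset.sum_congr rfl fun j _ => by split_ifs <;> simp [sq_abs]
    rw [hu2, hw2] at hCS
    have habs : |∑ j, ∑ k, (Real.exp (φ j - φ k) - 1) * (u b j * u b k) * (w j * w k)| ≤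
        ε b * (∑ k, u b k ^ 2) * W b := by
      calc |∑ j, ∑ k, (Real.exp (φ j - φ k) - 1) * (u b j * u b k) * (w j * w k)|
          ≤ ∑ j, ∑ k, |(Real.exp (φ j - φ k) - 1) * (u b j * u b k) * (w j * w k)| :=
            (Finset.abs_sum_le_sum_abs _ _).trans (Finset.sum_le_sum fun j _ => Finset.abs_sum_le_sum_abs _ _)
        _ ≤ ∑ j, ∑ k, ε b * (|u b j| * |if blk j = b then w j else 0|) *
              (|u b k| * |if blk k = b then w k else 0|) :=
            Finset.sum_le_sum fun j _ => Finset.sum_le_sum fun k _ => hterm j k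
        _ = ε b * (∑ j, |u b j| * |if blk j = b then w j else 0|) ^ 2 := by
            rw [pow_two, Finset.sum_mul_sum, Finset.mul_sum]
            refine Finset.sum_congr rfl fun j _ => ?_
            rw [Finset.mul_sum]
            exact Finset.sum_congr rfl fun k _ => by ring
        _ ≤ ε b * ((∑ k, u b k ^ 2) * W b) := mul_le_mul_of_nonneg_left hCS (hε0 b)
        _ = ε b * (∑ k, u b k ^ 2) * W b := by ring
    linarith [(abs_le.1 habs).1]
  -- sum over blocks
  rw [hpull]
  calc -κ * (w ⬝ᵥ w) = ∑ b, -(κ * W b) := by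
        rw [← hWsum, Finset.mul_sum]
        exact Finset.sum_congr rfl fun b _ => by ring
    _ ≤ ∑ b, -(m b * (ε b * (∑ k, u b k ^ 2) * W b)) := by
        refine Finset.sum_le_sum fun b _ => ?_
        have h1 : m b * ε b * (∑ k, u b k ^ 2) * W b ≤ κ * W b :=
          mul_le_mul_of_nonneg_right (hκ b) (hW0 b)
        linarith
    _ ≤ ∑ b, m b * ∑ j, ∑ k, (Real.exp (φ j - φ k) - 1) * (u b j * u b k) * (w j * w k) := by
        refine Finset.sum_le_sum fun b _ => ?_
        have h1 := mul_le_mul_of_nonneg_left (hblock b) (hm b)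
        linarith

/-! ## §3  Assembly: Laplacian + block projections -/

/-- **Combes–Thomas for `H = lap c + Σ_b m_b u_b ⊗ u_b`** (the shape of `Δ^η + aQ*Q`): if `σ‖ω‖² ≤ ⟨ω,Hω⟩`, the
Laplacian row defects `Σ_k c_jk (cosh(φ_j − φ_k) − 1)` are `≤ κΔ`, the block defects `m_b ε_b ‖u_b‖²` are `≤ κQ`
(`ε_b` bounding the oscillation `|e^{φ_j−φ_k} − 1|` on block `b`), and `κΔ + κQ ≤ σ/2`, then every solution of
`Hv = e_{k₀}` satisfies `|v_i| ≤ (2/σ) e^{−(φ_i − φ_{k₀})}`.  With `c_jk = η⁻²` on nearest neighbours and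
`|φ_j − φ_k| ≤ δη ≤ 1` across bonds, §0 makes `κΔ ≤ (#neighbours)·δ²` INDEPENDENT of `η`. [cite: CombesThomas1973, §II] [folklore] -/
theorem combesThomas_lap_add_blocks {β : Type*} [Fintype β] [DecidableEq β]
    (c : n → n → ℝ) (hc : ∀ j k, c j k = c k j) (hc0 : ∀ j k, 0 ≤ c j k)
    (blk : n → β) (m : β → ℝ) (hm : ∀ b, 0 ≤ m b) (u : β → n → ℝ) (hu : ∀ b j, blk j ≠ b → u b j = 0)
    (H : Matrix n n ℝ) (hH : ∀ j k, H j k = lap c j k + ∑ b, m b * (u b j * u b k))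
    (σ : ℝ) (hσ : 0 < σ) (hpos : ∀ ω : n → ℝ, σ * (ω ⬝ᵥ ω) ≤ ω ⬝ᵥ H.mulVec ω)
    (φ : n → ℝ) (κΔ κQ : ℝ) (hκΔ : ∀ j, ∑ k, c j k * (Real.cosh (φ j - φ k) - 1) ≤ κΔ)
    (ε : β → ℝ) (hε0 : ∀ b, 0 ≤ ε b)
    (hε : ∀ b j k, blk j = b → blk k = b → |Real.exp (φ j - φ k) - 1| ≤ ε b)
    (hκQ : ∀ b, m b * ε b * ∑ k, u b k ^ 2 ≤ κQ) (hsmall : κΔ + κQ ≤ σ / 2)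
    (k₀ : n) (v : n → ℝ) (hv : H.mulVec v = Pi.single k₀ 1) (i : n) :
    |v i| ≤ 2 / σ * Real.exp (-(φ i - φ k₀)) := by
  refine combesThomas_form H σ φ hσ hpos (fun w => ?_) k₀ v hv i
  have h1 := conjError_lap_ge c hc hc0 φ κΔ hκΔ w
  have h2 := conjError_blocks_ge blk m hm u hu φ ε hε0 hε κQ hκQ w
  have hsplit : ∑ j, ∑ k, (Real.exp (φ j - φ k) - 1) * H j k * (w j * w k)
      = ∑ j, ∑ k, (Real.exp (φ j - φ k) - 1) * lap c j k * (w j * w k)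
        + ∑ j, ∑ k, (Real.exp (φ j - φ k) - 1) * (∑ b, m b * (u b j * u b k)) * (w j * w k) := by
    rw [← Finset.sum_add_distrib]
    refine Finset.sum_congr rfl fun j _ => ?_
    rw [← Finset.sum_add_distrib]
    exact Finset.sum_congr rfl fun k _ => by rw [hH j k]; ring
  have hww : 0 ≤ w ⬝ᵥ w := by
    simp only [dotProduct]; exact Finset.sum_nonneg fun j _ => mul_self_nonneg _
  rw [hsplit]
  nlinarith

/-! ## §4  The defects in the lattice shape — the smallness condition does not see the spacing `η` -/

/-- `|e^t − 1| ≤ e^θ − 1` for `|t| ≤ θ`. [folklore] -/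
theorem abs_exp_sub_one_le {t θ : ℝ} (h : |t| ≤ θ) : |Real.exp t - 1| ≤ Real.exp θ - 1 := by
  have ht := abs_le.1 h
  rw [abs_sub_le_iff]
  constructor
  · linarith [Real.exp_le_exp.2 ht.2]
  · have h3 : Real.exp (-θ) ≤ Real.exp t := Real.exp_le_exp.2 (by linarith)
    linarith [Real.add_one_le_exp θ, Real.add_one_le_exp (-θ)]

omit [DecidableEq n] in
/-- **Laplacian defect in the lattice shape.**  Bond coefficients `η⁻²` on at most `z` neighbours per site and a
weight oscillating by at most `δη ≤ 1` across each bond give a row defect `≤ z·δ²` — INDEPENDENT of `η` (this is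
where the form version beats the entrywise one, whose smallness parameter would be `η⁻²(e^{δη} − 1) ≈ δ/η`).
[folklore] -/
theorem lapDefect_le (c : n → n → ℝ) (φ : n → ℝ) {η δ z : ℝ} (hη : 0 < η) (h1 : δ * η ≤ 1)
    (hc : ∀ j k, c j k ≠ 0 → c j k = (η ^ 2)⁻¹ ∧ |φ j - φ k| ≤ δ * η)
    (hz : ∀ j, ((univ.filter fun k => c j k ≠ 0).card : ℝ) ≤ z) (j : n) :
    ∑ k, c j k * (Real.cosh (φ j - φ k) - 1) ≤ z * δ ^ 2 := by
  have hterm : ∀ k, c j k * (Real.cosh (φ j - φ k) - 1) ≤ if c j k ≠ 0 then δ ^ 2 else 0 := by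
    intro k
    by_cases h : c j k ≠ 0
    · rw [if_pos h]
      obtain ⟨hck, hφ⟩ := hc j k h
      rw [hck]
      exact inv_sq_mul_cosh_sub_one_le hη hφ h1
    · rw [if_neg h]
      simp only [ne_eq, not_not] at h
      rw [h, zero_mul]
  calc ∑ k, c j k * (Real.cosh (φ j - φ k) - 1) ≤ ∑ k, (if c j k ≠ 0 then δ ^ 2 else (0 : ℝ)) :=
        Finset.sum_le_sum fun k _ => hterm k
    _ = ((univ.filter fun k => c j k ≠ 0).card : ℝ) * δ ^ 2 := by
        rw [Finset.sum_ite, Finset.sum_const_zero, add_zero, Finset.sum_const, nsmul_eq_mul]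
    _ ≤ z * δ ^ 2 := mul_le_mul_of_nonneg_right (hz j) (sq_nonneg _)

omit [Fintype n] [DecidableEq n] in
/-- **Block defect.**  If the weight oscillates by at most `Θ` on every block then `ε_b := e^Θ − 1` qualifies in
`conjError_blocks_ge` / `combesThomas_lap_add_blocks`. [folklore] -/
theorem blockDefect_le {β : Type*} (blk : n → β) (φ : n → ℝ) (Θ : ℝ)
    (hΘ : ∀ j k, blk j = blk k → |φ j - φ k| ≤ Θ) (b : β) (j k : n) (hj : blk j = b) (hk : blk k = b) :
    |Real.exp (φ j - φ k) - 1| ≤ Real.exp Θ - 1 :=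
  abs_exp_sub_one_le (hΘ j k (hj.trans hk.symm))

/-- **Combes–Thomas in the lattice shape `Δ^η + aQ*Q` — the all-`η` form.**  `H = lap c + Σ_b m_b u_b ⊗ u_b` with:
bond coefficients `η⁻²` on at most `z` neighbours, the weight `φ` oscillating by `≤ δη ≤ 1` across bonds and by `≤ Θ`
on blocks (`Θ ≥ 0`), block strengths `m_b‖u_b‖² ≤ a`, coercivity `σ‖ω‖² ≤ ⟨ω, Hω⟩`.  If
`z δ² + a (e^Θ − 1) ≤ σ/2` — a condition in which `η` DOES NOT APPEAR — then `|H⁻¹(i,k₀)| ≤ (2/σ) e^{−(φ_i − φ_{k₀})}`.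
For the fine torus of mesh `η = 1/n` (`z = 2d`, blocks = unit cubes, `φ = δ·dist`, `Θ = δd`) this is the decay of
the counting-coordinate entries `(H⁻¹)_{xy} = η^d G₀(x, y)` of `G₀ = (Δ^η + aQ*Q)⁻¹` with rate and constant depending
on `d, a, σ(d,a)` only, for EVERY `n`; the `η`-uniform cube-to-cube (`L²`-operator) statement for member 1 of
(L6-unit″) is the operator form `Beta/CombesThomasFormOp.setDecay_lattice_dist` / `Beta/TorusG0Decay.setDecay_torus`
(v1.0.1 docstring correction, G-pv23g3-3).
[cite: CombesThomas1973, §II] [folklore] -/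
theorem combesThomas_lattice {β : Type*} [Fintype β] [DecidableEq β]
    (c : n → n → ℝ) (hcs : ∀ j k, c j k = c k j) (hc0 : ∀ j k, 0 ≤ c j k)
    (blk : n → β) (m : β → ℝ) (hm : ∀ b, 0 ≤ m b) (u : β → n → ℝ) (hu : ∀ b j, blk j ≠ b → u b j = 0)
    (H : Matrix n n ℝ) (hH : ∀ j k, H j k = lap c j k + ∑ b, m b * (u b j * u b k))
    (σ : ℝ) (hσ : 0 < σ) (hpos : ∀ ω : n → ℝ, σ * (ω ⬝ᵥ ω) ≤ ω ⬝ᵥ H.mulVec ω)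
    (φ : n → ℝ) {η δ z a Θ : ℝ} (hη : 0 < η) (h1 : δ * η ≤ 1) (hΘ0 : 0 ≤ Θ)
    (hc : ∀ j k, c j k ≠ 0 → c j k = (η ^ 2)⁻¹ ∧ |φ j - φ k| ≤ δ * η)
    (hz : ∀ j, ((univ.filter fun k => c j k ≠ 0).card : ℝ) ≤ z)
    (hΘ : ∀ j k, blk j = blk k → |φ j - φ k| ≤ Θ)
    (ha : ∀ b, m b * ∑ k, u b k ^ 2 ≤ a)
    (hsmall : z * δ ^ 2 + a * (Real.exp Θ - 1) ≤ σ / 2)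
    (k₀ : n) (v : n → ℝ) (hv : H.mulVec v = Pi.single k₀ 1) (i : n) :
    |v i| ≤ 2 / σ * Real.exp (-(φ i - φ k₀)) := by
  have hε0 : 0 ≤ Real.exp Θ - 1 := by linarith [Real.add_one_le_exp Θ]
  refine combesThomas_lap_add_blocks c hcs hc0 blk m hm u hu H hH σ hσ hpos φ (z * δ ^ 2)
    (a * (Real.exp Θ - 1)) (lapDefect_le c φ hη h1 hc hz) (fun _ => Real.exp Θ - 1) (fun _ => hε0)
    (fun b j k hj hk => blockDefect_le blk φ Θ hΘ b j k hj hk) (fun b => ?_) hsmall k₀ v hv i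
  calc m b * (Real.exp Θ - 1) * ∑ k, u b k ^ 2 = (Real.exp Θ - 1) * (m b * ∑ k, u b k ^ 2) := by ring
    _ ≤ (Real.exp Θ - 1) * a := mul_le_mul_of_nonneg_left (ha b) hε0
    _ = a * (Real.exp Θ - 1) := mul_comm _ _

/-- Sanity instance: on a `2`-site index set the graph Laplacian of the constant coefficient `1` has off-diagonal
entry `−1` (checks the sign convention of `lap`). -/
example : lap (fun _ _ : Fin 2 => (1 : ℝ)) 0 1 = -1 := by
  simp [lap_apply]

end Literature.MathematicalPhysics.QuantumFieldTheory.Balaban1983to89.Beta.CombesThomasForm
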